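import Summits.ValiantsHypothesis.ValiantsHypothesis.Theorems.LacunarySymmetroidMatrixDescartesCensusDefiniteMiddleK3Roots
import Summits.ValiantsHypothesis.ValiantsHypothesis.Theorems.LacunarySymmetroidMatrixDescartesCensusDefiniteMiddleK3LawWalkA
import Summits.ValiantsHypothesis.ValiantsHypothesis.Theorems.LacunarySymmetroidMatrixDescartesCensusDefiniteMiddleK3LawWalkB

/-!
# `MatrixDescartes` census — DOOR A: the INTERIOR-DEFINITE-LETTER LAW AT `(2,3)` (IDL(3), identity gauge) —
# a real symmetric pencil `S₀ + x^d·1 + x^e·S₂` (`0 < d < e`) has at most FOUR distinct positive det-roots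

HONEST FRAMING.  Object-search cell `pub-symmetroid`, door-A seat `val-sym-door-p4` (gen 15); items stmt-ValiantsHypothesis-19979
`DoorA26` / 19980 `DoorA34` (OPEN, typed, never asserted); helper `--supports 19979`, NO closure claim.  This is the `K = 3`
instance of the cell's conjecture C-g3-2 / the interior-definite-letter law (theory g3 proved it on paper as THEOREM L5(iii) by
rigidity + certified anchors; here a direct kernel proof), first in the IDENTITY GAUGE `S₁ = 1`, then for ANY definite middle letter by the explicit `2 × 2` Cholesky congruence
`S₁ = ±BᵀB` (`det(BᵀMB) = det(B)²·det M` as polynomials, `roots_C_mul`), and finally in census currency.  `D(2,3) = 5`, so this is the one-unit Descartes deficiency `≤ 4`.  Nothing here bounds `ζ_sym(2,6)`,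
decides `DoorA26`/`DoorA34`, or bears on `MatrixDescartes` (stmt-ValiantsHypothesis-18050) / `VP ≠ VNP`; the `K = 6` law IDL26
(worth `990` open chambers, `…CensusInteriorDefiniteBridge`) stays OPEN.

PROOF (memo `IDL-doorp4g15.md` §3): `five_roots_structure` (`…K3Roots`: five distinct positive roots are Descartes-sharp on six
monomials, hence simple, sorted, alternating, the only ones, with nonsingular end letters) feeds `no_five_roots_of_walkA/B`
(`…K3LawWalkA/B`, by the sign of `det F` on the first gap: the caps/lenses/wraps analysis with the future-type and past-type laws).

* **`card_posRoots_le_four_identityMiddle`** — THE LAW in the identity gauge: `#{x > 0 : det(S₀ + x^d·1 + x^e·S₂) = 0} ≤ 4`;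
* `cholesky_two`, **`card_posRoots_le_four_definiteMiddle`** — any middle letter with `det S₁ > 0` (positive or negative definite);
* **`posRoots_three_le_four_of_definite_middle`** — census currency: `∑ l, X^(d l) • S l` with `d 0 < d 1 < d 2` and a definite
  middle letter has at most `4 = D(2,3) − 1` distinct positive det-roots.

[folklore] Elementary; Cholesky factorisation of a `2 × 2` positive definite matrix.  Axioms standard; no definitions.
-/

-- the D-0017 layout repeats a namespace component (single-conjunct summit); the `dupNamespace` linter flags it; name mandated.
set_option linter.dupNamespace false

namespace Summit.ValiantsHypothesis.ValiantsHypothesis.Theorems.LacunarySymmetroidMatrixDescartes.Census.DefiniteMiddle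

open Real Matrix Finset Polynomial
open scoped BigOperators

/-- **THE INTERIOR-DEFINITE-LETTER LAW AT `(2,3)` (identity gauge).**  For real symmetric `S₀, S₂` and `0 < d < e` the
determinant of `S₀ + X^d·1 + X^e·S₂` has at most four distinct positive roots (one less than the Descartes bound
`D(2,3) = 5`). [folklore] -/
theorem card_posRoots_le_four_identityMiddle (S₀ S₂ : Matrix (Fin 2) (Fin 2) ℝ) (hS₀ : S₀.IsSymm) (hS₂ : S₂.IsSymm)
    {d e : ℕ} (hd : 0 < d) (hde : d < e) :
    ((Matrix.det (S₀.map C + (X : ℝ[X]) ^ d • (1 : Matrix (Fin 2) (Fin 2) ℝ[X]) + (X : ℝ[X]) ^ e • S₂.map C)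
      ).roots.toFinset.filter (fun x => 0 < x)).card ≤ 4 := by
  by_contra h5
  obtain ⟨r, hrmono, hrpos, hrroot, hgap0, hgap, halt, hdS₀, hdS₂⟩ :=
    five_roots_structure S₀ S₂ hS₀ hS₂ hd hde (by omega)
  rcases lt_or_gt_of_ne (hgap0 (r 0 / 2) (by linarith [hrpos 0]) (by linarith [hrpos 0])).symm with hA | hB
  · exact no_five_roots_of_walkA S₀ S₂ hS₀ hS₂ hd hde r hrmono hrpos hrroot hgap0 hgap halt hdS₀ hA
  · exact no_five_roots_of_walkB S₀ S₂ hS₀ hS₂ hd hde r hrmono hrpos hrroot hgap0 hgap halt hdS₂ hB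



/-- **Explicit `2 × 2` Cholesky factor.**  For `a > 0` and `a·c − b² > 0` the upper-triangular
`B = [[√a, b/√a],[0, √((ac − b²)/a)]]` satisfies `BᵀB = [[a,b],[b,c]]` and `det B ≠ 0`. [folklore] -/
theorem cholesky_two (S : Matrix (Fin 2) (Fin 2) ℝ) (hS : S 1 0 = S 0 1) (ha : 0 < S 0 0)
    (hdet : 0 < S 0 0 * S 1 1 - S 0 1 ^ 2) :
    ∃ B : Matrix (Fin 2) (Fin 2) ℝ, B.det ≠ 0 ∧ Bᵀ * B = S := by
  set p := Real.sqrt (S 0 0) with hp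
  set s := Real.sqrt ((S 0 0 * S 1 1 - S 0 1 ^ 2) / S 0 0) with hs
  have hp0 : 0 < p := Real.sqrt_pos.mpr ha
  have hs0 : 0 < s := Real.sqrt_pos.mpr (div_pos hdet ha)
  have hp2 : p ^ 2 = S 0 0 := Real.sq_sqrt ha.le
  have hs2 : s ^ 2 = (S 0 0 * S 1 1 - S 0 1 ^ 2) / S 0 0 := Real.sq_sqrt (div_pos hdet ha).le
  refine ⟨!![p, S 0 1 / p; 0, s], ?_, ?_⟩
  · rw [Matrix.det_fin_two_of]; simp; exact ⟨hp0.ne', hs0.ne'⟩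
  · ext i j
    fin_cases i <;> fin_cases j <;>
      simp [Matrix.mul_apply, Fin.sum_univ_two, Matrix.transpose_apply, hS]
    · nlinarith [hp2]
    · field_simp
    · field_simp
    · have hp0' : p ≠ 0 := hp0.ne'
      field_simp
      rw [hs2] at *
      field_simp
      nlinarith [hp2, hs2]

/-- **IDL(3) — a `(2,3)` pencil with a DEFINITE middle letter has at most four distinct positive det-roots.**
`S₀, S₁, S₂` real symmetric, `det S₁ > 0` (so `S₁` is positive or negative definite), `0 < d < e`:
`#{x > 0 : det(S₀ + x^d S₁ + x^e S₂) = 0} ≤ 4 = D(2,3) − 1`. [folklore] -/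
theorem card_posRoots_le_four_definiteMiddle (S₀ S₁ S₂ : Matrix (Fin 2) (Fin 2) ℝ) (hS₀ : S₀.IsSymm) (hS₁ : S₁.IsSymm)
    (hS₂ : S₂.IsSymm) (hdet : 0 < S₁ 0 0 * S₁ 1 1 - S₁ 0 1 ^ 2) {d e : ℕ} (hd : 0 < d) (hde : d < e) :
    ((Matrix.det (S₀.map C + (X : ℝ[X]) ^ d • S₁.map C + (X : ℝ[X]) ^ e • S₂.map C)
      ).roots.toFinset.filter (fun x => 0 < x)).card ≤ 4 := by
  classical
  -- ### reduce to `S₁ 0 0 > 0` by the global sign change `S ↦ −S`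
  wlog hpos : 0 < S₁ 0 0 generalizing S₀ S₁ S₂
  · have h00 : S₁ 0 0 ≠ 0 := by
      intro h0; rw [h0, zero_mul] at hdet; nlinarith [sq_nonneg (S₁ 0 1)]
    have hneg : 0 < (-S₁) 0 0 := by
      simp only [Matrix.neg_apply, Left.neg_pos_iff]
      exact lt_of_le_of_ne (not_lt.mp hpos) h00
    have h := this (-S₀) (-S₁) (-S₂) hS₀.neg hS₁.neg hS₂.neg (by simpa using hdet) hneg
    have hmat : (-S₀).map C + (X : ℝ[X]) ^ d • (-S₁).map C + (X : ℝ[X]) ^ e • (-S₂).map C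
        = -(S₀.map C + (X : ℝ[X]) ^ d • S₁.map C + (X : ℝ[X]) ^ e • S₂.map C) := by
      ext i j; simp [Matrix.map_apply]; ring
    rw [hmat, Matrix.det_neg] at h
    simpa using h
  -- ### Cholesky `S₁ = BᵀB` and the congruent letters
  obtain ⟨B, hBdet, hBS⟩ := cholesky_two S₁ (hS₁.apply 0 1) hpos hdet
  have hBu : IsUnit B.det := isUnit_iff_ne_zero.mpr hBdet
  have hBtu : IsUnit Bᵀ.det := by rwa [Matrix.det_transpose]
  set S₀' := (Bᵀ)⁻¹ * S₀ * B⁻¹ with hS₀'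
  set S₂' := (Bᵀ)⁻¹ * S₂ * B⁻¹ with hS₂'
  have h1 : Bᵀ * (Bᵀ)⁻¹ = 1 := Matrix.mul_nonsing_inv _ hBtu
  have h2 : B⁻¹ * B = 1 := Matrix.nonsing_inv_mul _ hBu
  have hc0 : Bᵀ * S₀' * B = S₀ := by
    calc Bᵀ * S₀' * B = (Bᵀ * (Bᵀ)⁻¹) * S₀ * (B⁻¹ * B) := by rw [hS₀']; simp only [Matrix.mul_assoc]
      _ = S₀ := by rw [h1, h2, Matrix.one_mul, Matrix.mul_one]
  have hc2 : Bᵀ * S₂' * B = S₂ := by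
    calc Bᵀ * S₂' * B = (Bᵀ * (Bᵀ)⁻¹) * S₂ * (B⁻¹ * B) := by rw [hS₂']; simp only [Matrix.mul_assoc]
      _ = S₂ := by rw [h1, h2, Matrix.one_mul, Matrix.mul_one]
  have hsym0 : S₀'.IsSymm := by
    rw [hS₀']; unfold Matrix.IsSymm
    rw [Matrix.transpose_mul, Matrix.transpose_mul, Matrix.transpose_nonsing_inv, Matrix.transpose_nonsing_inv,
      Matrix.transpose_transpose, hS₀.eq, Matrix.mul_assoc]
  have hsym2 : S₂'.IsSymm := by
    rw [hS₂']; unfold Matrix.IsSymm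
    rw [Matrix.transpose_mul, Matrix.transpose_mul, Matrix.transpose_nonsing_inv, Matrix.transpose_nonsing_inv,
      Matrix.transpose_transpose, hS₂.eq, Matrix.mul_assoc]
  -- ### the polynomial pencils are congruent, their determinants differ by `det B²`
  set Bc : Matrix (Fin 2) (Fin 2) ℝ[X] := B.map C with hBc
  have hpencil : S₀.map C + (X : ℝ[X]) ^ d • S₁.map C + (X : ℝ[X]) ^ e • S₂.map C
      = Bcᵀ * (S₀'.map C + (X : ℝ[X]) ^ d • (1 : Matrix (Fin 2) (Fin 2) ℝ[X]) + (X : ℝ[X]) ^ e • S₂'.map C) * Bc := by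
    rw [← hc0, ← hc2, ← hBS, hBc]
    simp only [Matrix.map_mul, Matrix.transpose_map, Matrix.mul_add, Matrix.add_mul, Matrix.mul_smul, Matrix.smul_mul,
      Matrix.mul_one]
  have hdetBc : Bc.det = C B.det := by
    rw [hBc, ← RingHom.mapMatrix_apply, ← RingHom.map_det]
  have hP : Matrix.det (S₀.map C + (X : ℝ[X]) ^ d • S₁.map C + (X : ℝ[X]) ^ e • S₂.map C)
      = C (B.det ^ 2) * Matrix.det (S₀'.map C + (X : ℝ[X]) ^ d • (1 : Matrix (Fin 2) (Fin 2) ℝ[X])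
          + (X : ℝ[X]) ^ e • S₂'.map C) := by
    rw [hpencil, Matrix.det_mul, Matrix.det_mul, Matrix.det_transpose, hdetBc, map_pow]
    ring
  rw [hP, Polynomial.roots_C_mul _ (pow_ne_zero 2 hBdet)]
  exact card_posRoots_le_four_identityMiddle S₀' S₂' hsym0 hsym2 hd hde


/-- **IDL(3) in census currency.**  For every sorted three-term support `d 0 < d 1 < d 2` and real symmetric `2 × 2` letters
`S 0, S 1, S 2` whose MIDDLE letter is definite (`det (S 1) > 0`), the lacunary pencil `∑ l, X^(d l) • S l` has at most
`4 = D(2,3) − 1` distinct positive det-roots. [folklore] -/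
theorem posRoots_three_le_four_of_definite_middle (d : Fin 3 → ℕ) (hd : StrictMono d)
    (S : Fin 3 → Matrix (Fin 2) (Fin 2) ℝ) (hS : ∀ l, (S l).IsSymm)
    (hdef : 0 < S 1 0 0 * S 1 1 1 - S 1 0 1 ^ 2) :
    ((Matrix.det (∑ l, ((X : ℝ[X]) ^ d l) • (S l).map C)).roots.toFinset.filter (fun t => 0 < t)).card ≤ 4 := by
  classical
  have h01 : d 0 < d 1 := hd (by decide)
  have h12 : d 1 < d 2 := hd (by decide)
  set Q := Matrix.det ((S 0).map C + (X : ℝ[X]) ^ (d 1 - d 0) • (S 1).map C + (X : ℝ[X]) ^ (d 2 - d 0) • (S 2).map C)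
    with hQ
  have hsum : (∑ l, ((X : ℝ[X]) ^ d l) • (S l).map C)
      = (X : ℝ[X]) ^ d 0 • ((S 0).map C + (X : ℝ[X]) ^ (d 1 - d 0) • (S 1).map C + (X : ℝ[X]) ^ (d 2 - d 0) • (S 2).map C) := by
    rw [Fin.sum_univ_three, smul_add, smul_add, smul_smul, smul_smul, ← pow_add, ← pow_add,
      Nat.add_sub_cancel' h01.le, Nat.add_sub_cancel' (h01.trans h12).le]
  have hdet : Matrix.det (∑ l, ((X : ℝ[X]) ^ d l) • (S l).map C) = (X : ℝ[X]) ^ (2 * d 0) * Q := by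
    rw [hsum, Matrix.det_smul, Fintype.card_fin, hQ, ← pow_mul, mul_comm (d 0) 2]
  have hQ4 := card_posRoots_le_four_definiteMiddle (S 0) (S 1) (S 2) (hS 0) (hS 1) (hS 2) hdef
    (Nat.sub_pos_of_lt h01) (Nat.sub_lt_sub_right h01.le h12)
  rw [← hQ] at hQ4
  rw [hdet]
  by_cases hQ0 : Q = 0
  · rw [hQ0, mul_zero]; simp
  · have hne : (X : ℝ[X]) ^ (2 * d 0) * Q ≠ 0 := mul_ne_zero (pow_ne_zero _ X_ne_zero) hQ0
    rw [Polynomial.roots_mul hne, Polynomial.roots_X_pow, Multiset.toFinset_add, Finset.filter_union]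
    refine (Finset.card_union_le _ _).trans ?_
    have h0 : ((2 * d 0) • ({0} : Multiset ℝ)).toFinset.filter (fun t : ℝ => 0 < t) = ∅ := by
      ext t
      simp only [Finset.mem_filter, Multiset.mem_toFinset, Multiset.mem_nsmul, Multiset.mem_singleton,
        Finset.notMem_empty, iff_false, not_and, not_lt]
      rintro ⟨-, rfl⟩; exact le_rfl
    rw [h0, Finset.card_empty, zero_add]
    exact hQ4


end Summit.ValiantsHypothesis.ValiantsHypothesis.Theorems.LacunarySymmetroidMatrixDescartes.Census.DefiniteMiddle
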